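/-
COR-CM (cell pub-hodgecm2, stage 2 of the Hodge ladder) — count-neutral KERNEL COMBINATORICS «the index-two cyclic law» (modular ∪ semidihedral
columns), part VI: THE LAW `μ(G, c) = β − 1 = φ₂` (seat prover-pub-hodgecm2-b23-g49-0, binder prover b23, gen 49; claim «INDEX-TWO CYCLIC LAW»,
HOME/INBOX.md l.22678).  Theorems only, on parts I–V (`Census/IndexTwoCyclic{Datum,ArcPairs,Descent,ArcHodge,ArcLattice}.lean`), the census seat
lit-andre-3ʼs type-stabiliser subgroup and closed form (`TypeStabiliser.stabGen`, `stabGen_le_iff_subset`, `stabGen_normal`, `IndexTwo.indexTwoRank_ne_zero`,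
`fibreTwo_add_two_eq_card_block_add_indexTwoRank`: `Census/TypeStabiliserSubgroup.lean`, `Census/TypeStabiliserIndexTwoRank.lean`, `Census/TypeStabiliserCharK.lean`)
seat b09ʼs coinvariant floor (`Coinvariant.fibreTwo_le_card`: `Census/CoinvariantFloor.lean`) and seat b23 gen 40ʼs
`ComplementFaces.pow_eq_self_of_odd` (`Census/ComplementFacesBlockCount.lean`), all BY NAME; no `decide`, no certificate, no named
fact, no `sorry`; `Interfaces.lean` (C1), every E term, B01, `Transposition/*`, `PortJoin/*`, `D2Bridge/*` untouched.
HONEST FRAMING: `HC_CM` is NOT proved, here or anywhere in the tree; nothing here is a period, a count of record or a headline.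
T5: n/a-class (hypothesis binders = the fields of `IndexTwoCyclic.Datum`, `c·c = 1`, `c ≠ 1`, and EITHER an index-two subgroup `H₂ ∋ c` whose outside
elements carry `c` among their powers OR `n` even + the odd coset elements `uⁱ·w` carry `c` among their powers — inhabited by the modular groups
`M_{2^k}` (`(uⁱw)² = u^{(n+2)i}`) and the semidihedral groups `SD_{2^k}` (`(uⁱw)² = cⁱ`), `k ≥ 4`; checker: self).
-/
import Summits.HodgeConjecture.CorCM.Census.IndexTwoCyclicArcLattice
import Summits.HodgeConjecture.CorCM.Census.TypeStabiliserCharK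
import Summits.HodgeConjecture.CorCM.Census.CoinvariantFloor
import Summits.HodgeConjecture.CorCM.Census.ComplementFacesBlockCount

/-!
# The index-two cyclic law, VI: `μ(G, c) = β − 1 = φ₂` along every index-two cyclic datum whose odd coset carries `c`

THE SETTING of parts I–V: an index-two cyclic datum `D` for `(G, c)` — `G ⊃ ⟨u⟩` cyclic of index two, `u` of order `2n`, `c = uⁿ`, `w ∉ ⟨u⟩` an
involution, `w·u = uʳ·w` (`G ≅ ℤ/2n ⋊_r ℤ/2`).  Part V gave, for EVERY twist `r`, a generating family of `β − 1` face relations.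

**MAIN THEOREM (`isLeast_card_gfaces_generate_of_odd_coset`, `…_fibreTwo`).**  Suppose `n` is even and every odd coset element `uⁱ·w`, `i` odd, has `c`
among its powers (equivalently `v₂(r + 1) < v₂(2n)`; the MODULAR groups `M_{2^k}`, `r = n + 1`, the SEMIDIHEDRAL groups `SD_{2^k}`, `r = n − 1`, and all
their mixed relatives `ℤ/2n ⋊_r ℤ/2`, e.g. `M₁₆ × ℤ/3`, `SD₁₆ × ℤ/3`, `G(24,5)`, `G(24,11)`).  Then the least number of rank-four face relations whose
base changes generate the integer Hodge lattice of `(G, c)` modulo the pairs is EXACTLY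
  **`β(G, c) − 1 = φ₂(G, c)`**,
and `d₂(G/𝒦) = 1` (`indexTwoRank_stabGen_eq_one_of_odd_coset`).  Rows: `M₁₆ 17 = 18 − 1`, `SD₁₆ 19 = 20 − 1`, `M₃₂ 2063`, `SD₃₂ 2111`.  With seat b23
gen 38 (`ℤ/2^k`), seat b09ʼs twisted census (`ℤ/2^{k−1} × ℤ/2`), seat b23 gen 48 (`D_{2^k}`) and seat b09ʼs quaternion column (`Q_{2^k}`) this makes
`μ = φ₂` a kernel theorem for EVERY 2-group with a cyclic maximal subgroup and its central involution.

* §1 THE FLOOR, generic form: an index-two subgroup `H₂ ∋ c` all of whose outside elements carry `c` among their powers contains the type-stabiliser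
  subgroup `𝒦` (`stabGen_le_of_powers`), so `d₂(G/𝒦) ≥ 1` and `β ≤ φ₂ + 1` (`card_block_le_fibreTwo_add_one`; `|G|/2 = 2n` is even along the datum).
* §2 THE LAW along `H₂` (`isLeast_card_gfaces_generate`, `card_block_eq_fibreTwo_add_one`, `isLeast_card_gfaces_generate_fibreTwo`, `indexTwoRank_stabGen_eq_one`).
* §3 THE INTRINSIC `H₂ = ⟨u², w⟩` (`Subgroup.closure {u², w}`): it consists of the `uⁱ`, `uⁱ·w` with `i` even (`exists_even_of_mem_closure`), has index two
  (`index_closure_eq_two`), contains `c` for `n` even, and a rotation `uⁱ` with `i` odd always carries `c` (`c_mem_zpowers_pow_of_odd`, Bézout) — so the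
  only hypothesis left is on the odd coset elements `uⁱ·w`.
* §4 THE LAW in datum terms (`…_of_odd_coset`).
Census dictionary: for every Galois CM field whose Galois group has a cyclic subgroup of index two containing complex conjugation, split by an involution
whose odd coset carries conjugation among its powers (modular / semidihedral closures), the Hodge ring of the whole isogeny slice is generated modulo
divisor classes by the Galois conjugates of exactly `β − 1` rank-four face classes, and no fewer Hodge generators exist.  Nothing here is a period.

## References
* [Pohlmann1968] H. Pohlmann, Algebraic cycles on abelian varieties of complex multiplication type, Ann. of Math. 88 (1968), Thm 1.
* [Milne1999] J. S. Milne, Lefschetz motives and the Tate conjecture, Compositio Math. 117 (1999), Prop. 2.1, p. 54.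
-/

namespace Summit.HodgeConjecture.CorCM.Census.IndexTwoCyclic

open Finset
open Summit.HodgeConjecture.CorCM.Prior.AllgGroup.RfwfAllgGroup
open Summit.HodgeConjecture.CorCM.Census.BlockParity
open Summit.HodgeConjecture.CorCM.Census.Coinvariant
open Summit.HodgeConjecture.CorCM.Census.TypeStabiliser
open Summit.HodgeConjecture.CorCM.Census.IndexTwo

noncomputable section

variable {G : Type*} [Group G] [Fintype G] [DecidableEq G] {c : G} {n : ℕ} [NeZero n]
variable (D : Datum G c n)

omit [DecidableEq G] in
include D in
/-- `c` is central along the datum (from `comm_pow_n`; file-local). [folklore] -/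
private theorem c_comm (y : G) : y * c = c * y := by
  have h := D.comm_pow_n y
  rwa [D.hun] at h

/-! ## §1 The floor, generic form -/

omit [Fintype G] [DecidableEq G] in
/-- **If every element outside an index-two subgroup `H₂ ∋ c` carries `c` among its powers, then `𝒦(G, c) ≤ H₂`.** [folklore] -/
theorem stabGen_le_of_powers (H₂ : Subgroup G) (hcH : c ∈ H₂) (hout : ∀ y : G, y ∉ H₂ → c ∈ Subgroup.zpowers y) :
    stabGen c ≤ H₂ :=
  (stabGen_le_iff_subset c).mpr ⟨hcH, fun g hg => by
    by_contra h
    exact hg (hout g h)⟩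

omit [DecidableEq G] in
/-- … hence `d₂(G/𝒦) ≠ 0` (central `c`, `H₂` of index two). [folklore] -/
theorem indexTwoRank_stabGen_ne_zero_of_powers (hcen : ∀ x : G, x * c = c * x) (H₂ : Subgroup G) (hH₂ : H₂.index = 2) (hcH : c ∈ H₂)
    (hout : ∀ y : G, y ∉ H₂ → c ∈ Subgroup.zpowers y) : indexTwoRank (stabGen c) ≠ 0 := by
  haveI := stabGen_normal c hcen
  exact indexTwoRank_ne_zero (stabGen c) hH₂ (stabGen_le_of_powers H₂ hcH hout)

/-- **THE FLOOR `β ≤ φ₂ + 1`** (`|G|/2` even; lit-andre-3ʼs closed form `φ₂ + 2 = β + d₂` with `d₂ ≥ 1`). [folklore] -/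
theorem card_block_le_fibreTwo_add_one (hc2 : c * c = 1) (hc1 : c ≠ 1) (hcen : ∀ x : G, x * c = c * x) (heven : Even (Fintype.card G / 2))
    (H₂ : Subgroup G) (hH₂ : H₂.index = 2) (hcH : c ∈ H₂) (hout : ∀ y : G, y ∉ H₂ → c ∈ Subgroup.zpowers y) :
    Fintype.card (Block c) ≤ fibreTwo c hc2 + 1 := by
  have h := fibreTwo_add_two_eq_card_block_add_indexTwoRank c hc2 hc1 hcen heven
  have h1 := indexTwoRank_stabGen_ne_zero_of_powers hcen H₂ hH₂ hcH hout
  omega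

/-! ## §2 The law along an index-two subgroup `H₂` -/

omit [DecidableEq G] [NeZero n] in
include D in
/-- `|G| = 4n` along the datum. [folklore] -/
private theorem card_eq_four_mul : Fintype.card G = 4 * n := by
  have h := (Subgroup.zpowers D.u).card_mul_index
  rw [Nat.card_zpowers, D.hord, D.hindex, Nat.card_eq_fintype_card] at h
  omega

omit [DecidableEq G] [NeZero n] in
include D in
/-- `|G|/2 = 2n` is even along the datum. [folklore] -/
private theorem even_card_div_two : Even (Fintype.card G / 2) :=
  ⟨n, by rw [card_eq_four_mul D]; omega⟩

include D in
/-- **FLOOR along `H₂`: every generating family of faces has at least `β − 1` members.** [folklore] -/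
theorem card_block_le_card_add_one (hc2 : c * c = 1) (hc1 : c ≠ 1) (H₂ : Subgroup G) (hH₂ : H₂.index = 2) (hcH : c ∈ H₂)
    (hout : ∀ y : G, y ∉ H₂ → c ∈ Subgroup.zpowers y) (S : Finset (CMF G c →₀ ℤ)) (hSF : (S : Set (CMF G c →₀ ℤ)) ⊆ gfaceSet G c hc2)
    (hgen : hodgeSpan c hc2 ≤ Submodule.span ℤ (pairSet c) ⊔ Submodule.span ℤ (translates c S)) :
    Fintype.card (Block c) ≤ S.card + 1 := by
  have h := fibreTwo_le_card c hc2 (c_comm D) S (Submodule.span ℤ (pairSet c)) le_rfl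
    (fun _ hy => gfaceSet_subset_hodgeSpan c hc2 (hSF hy)) (fun _ hy => hgen (gfaceSet_subset_hodgeSpan c hc2 hy))
  have h1 := card_block_le_fibreTwo_add_one hc2 hc1 (c_comm D) (even_card_div_two D) H₂ hH₂ hcH hout
  omega

include D in
/-- **THE LAW along `H₂`**: the least number of face relations whose base changes generate the integer Hodge lattice modulo the pairs is EXACTLY
`β − 1`, for every index-two cyclic datum admitting an index-two subgroup `H₂ ∋ c` whose outside elements carry `c`. [folklore] -/
theorem isLeast_card_gfaces_generate (hc2 : c * c = 1) (hc1 : c ≠ 1) (H₂ : Subgroup G) (hH₂ : H₂.index = 2) (hcH : c ∈ H₂)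
    (hout : ∀ y : G, y ∉ H₂ → c ∈ Subgroup.zpowers y) :
    IsLeast {m : ℕ | ∃ S : Finset (CMF G c →₀ ℤ), ↑S ⊆ gfaceSet G c hc2 ∧ S.card = m ∧
      hodgeSpan c hc2 ≤ Submodule.span ℤ (pairSet c) ⊔ Submodule.span ℤ (translates c S)} (Fintype.card (Block c) - 1) := by
  obtain ⟨S, hSF, hcard, hgen⟩ := exists_gfaces_generate D hc2
  have hge := card_block_le_card_add_one D hc2 hc1 H₂ hH₂ hcH hout S hSF hgen
  refine ⟨⟨S, hSF, by omega, hgen⟩, ?_⟩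
  rintro m ⟨S', hS'F, rfl, hgen'⟩
  have h := card_block_le_card_add_one D hc2 hc1 H₂ hH₂ hcH hout S' hS'F hgen'
  omega

include D in
/-- **`β = φ₂ + 1` along `H₂`.** [folklore] -/
theorem card_block_eq_fibreTwo_add_one (hc2 : c * c = 1) (hc1 : c ≠ 1) (H₂ : Subgroup G) (hH₂ : H₂.index = 2) (hcH : c ∈ H₂)
    (hout : ∀ y : G, y ∉ H₂ → c ∈ Subgroup.zpowers y) : Fintype.card (Block c) = fibreTwo c hc2 + 1 := by
  obtain ⟨S, hSF, hcard, hgen⟩ := exists_gfaces_generate D hc2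
  have h := fibreTwo_le_card c hc2 (c_comm D) S (Submodule.span ℤ (pairSet c)) le_rfl
    (fun _ hy => gfaceSet_subset_hodgeSpan c hc2 (hSF hy)) (fun _ hy => hgen (gfaceSet_subset_hodgeSpan c hc2 hy))
  have h1 := card_block_le_fibreTwo_add_one hc2 hc1 (c_comm D) (even_card_div_two D) H₂ hH₂ hcH hout
  omega

include D in
/-- **THE LAW in the coinvariant currency: `μ = φ₂` along `H₂`.** [folklore] -/
theorem isLeast_card_gfaces_generate_fibreTwo (hc2 : c * c = 1) (hc1 : c ≠ 1) (H₂ : Subgroup G) (hH₂ : H₂.index = 2) (hcH : c ∈ H₂)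
    (hout : ∀ y : G, y ∉ H₂ → c ∈ Subgroup.zpowers y) :
    IsLeast {m : ℕ | ∃ S : Finset (CMF G c →₀ ℤ), ↑S ⊆ gfaceSet G c hc2 ∧ S.card = m ∧
      hodgeSpan c hc2 ≤ Submodule.span ℤ (pairSet c) ⊔ Submodule.span ℤ (translates c S)} (fibreTwo c hc2) := by
  have h := card_block_eq_fibreTwo_add_one D hc2 hc1 H₂ hH₂ hcH hout
  have e : fibreTwo c hc2 = Fintype.card (Block c) - 1 := by omega
  rw [e]
  exact isLeast_card_gfaces_generate D hc2 hc1 H₂ hH₂ hcH hout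

include D in
/-- **`d₂(G/𝒦) = 1` along `H₂`** (the closed form `φ₂ + 2 = β + d₂` and `β = φ₂ + 1`). [folklore] -/
theorem indexTwoRank_stabGen_eq_one (hc2 : c * c = 1) (hc1 : c ≠ 1) (H₂ : Subgroup G) (hH₂ : H₂.index = 2) (hcH : c ∈ H₂)
    (hout : ∀ y : G, y ∉ H₂ → c ∈ Subgroup.zpowers y) : indexTwoRank (stabGen c) = 1 := by
  have h := fibreTwo_add_two_eq_card_block_add_indexTwoRank c hc2 hc1 (c_comm D) (even_card_div_two D)
  have h1 := card_block_eq_fibreTwo_add_one D hc2 hc1 H₂ hH₂ hcH hout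
  omega

/-! ## §3 The intrinsic index-two subgroup `⟨u², w⟩` -/

omit [Fintype G] [DecidableEq G] [NeZero n] in
/-- `uⁱ ∈ ⟨u², w⟩` for even `i`. [folklore] -/
theorem pow_mem_closure_of_even {i : ℕ} (hi : Even i) : D.u ^ i ∈ Subgroup.closure ({D.u ^ 2, D.w} : Set G) := by
  obtain ⟨j, rfl⟩ := hi
  rw [← two_mul, pow_mul]
  exact Subgroup.pow_mem _ (Subgroup.subset_closure (Set.mem_insert _ _)) j

omit [Fintype G] [DecidableEq G] [NeZero n] in
/-- `uⁱ·w ∈ ⟨u², w⟩` for even `i`. [folklore] -/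
theorem pow_mul_w_mem_closure_of_even {i : ℕ} (hi : Even i) : D.u ^ i * D.w ∈ Subgroup.closure ({D.u ^ 2, D.w} : Set G) :=
  Subgroup.mul_mem _ (pow_mem_closure_of_even D hi) (Subgroup.subset_closure (Set.mem_insert_of_mem _ (Set.mem_singleton _)))

omit [Fintype G] [DecidableEq G] in
/-- The inverse of a power of `u` as a power: `(uᵏ)⁻¹ = u^{k(2n−1)}`. [folklore] -/
theorem inv_pow_eq_pow (k : ℕ) : (D.u ^ k)⁻¹ = D.u ^ (k * (2 * n - 1)) := by
  apply inv_eq_of_mul_eq_one_right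
  rw [← pow_add]
  have hn : 1 ≤ n := Nat.one_le_iff_ne_zero.mpr (NeZero.ne n)
  have e : k + k * (2 * n - 1) = (2 * n) * k := by zify [show 1 ≤ 2 * n by omega]; ring
  rw [e, pow_mul, D.pow_two_mul, one_pow]

omit [Fintype G] [DecidableEq G] in
/-- **`⟨u², w⟩` consists of the `uⁱ`, `uⁱ·w` with `i` even.** [folklore] -/
theorem exists_even_of_mem_closure {y : G} (hy : y ∈ Subgroup.closure ({D.u ^ 2, D.w} : Set G)) :
    ∃ i : ℕ, Even i ∧ (y = D.u ^ i ∨ y = D.u ^ i * D.w) := by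
  induction hy using Subgroup.closure_induction with
  | mem x hx =>
    rcases hx with rfl | hx
    · exact ⟨2, even_two, Or.inl rfl⟩
    · rw [Set.mem_singleton_iff] at hx
      exact ⟨0, Even.zero, Or.inr (by rw [hx, pow_zero, one_mul])⟩
  | one => exact ⟨0, Even.zero, Or.inl (pow_zero _).symm⟩
  | mul x y _ _ hx hy =>
    obtain ⟨i, hi, rfl | rfl⟩ := hx <;> obtain ⟨j, hj, rfl | rfl⟩ := hy
    · exact ⟨i + j, hi.add hj, Or.inl (pow_add _ _ _).symm⟩
    · exact ⟨i + j, hi.add hj, Or.inr (by rw [← mul_assoc, ← pow_add])⟩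
    · exact ⟨i + D.r * j, hi.add (hj.mul_left _), Or.inr (by rw [mul_assoc, D.w_mul_pow, ← mul_assoc, ← pow_add])⟩
    · exact ⟨i + D.r * j, hi.add (hj.mul_left _), Or.inl (by
        rw [mul_assoc, ← mul_assoc D.w, D.w_mul_pow, mul_assoc, D.hww, mul_one, ← pow_add])⟩
  | inv x _ hx =>
    obtain ⟨i, hi, rfl | rfl⟩ := hx
    · exact ⟨i * (2 * n - 1), hi.mul_right _, Or.inl (inv_pow_eq_pow D i)⟩
    · exact ⟨D.r * (i * (2 * n - 1)), (hi.mul_right _).mul_left _, Or.inr (by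
        rw [mul_inv_rev, D.w_inv, inv_pow_eq_pow, D.w_mul_pow])⟩

omit [Fintype G] [DecidableEq G] [NeZero n] in
/-- Parities of exponents agree for equal powers of `u` (`2n` is even). [folklore] -/
theorem even_iff_of_pow_eq {i j : ℕ} (h : D.u ^ i = D.u ^ j) : (Even i ↔ Even j) := by
  rw [D.pow_eq_pow_iff, ZMod.natCast_eq_natCast_iff] at h
  have h2 : i % 2 = j % 2 := Nat.ModEq.of_dvd (dvd_mul_right 2 n) h
  rw [Nat.even_iff, Nat.even_iff, h2]

omit [Fintype G] [DecidableEq G] in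
/-- A rotation `uⁱ` with `i` odd is not in `⟨u², w⟩`. [folklore] -/
theorem pow_notMem_closure_of_odd {i : ℕ} (hi : Odd i) : D.u ^ i ∉ Subgroup.closure ({D.u ^ 2, D.w} : Set G) := fun h => by
  obtain ⟨j, hj, h' | h'⟩ := exists_even_of_mem_closure D h
  · exact (Nat.not_even_iff_odd.mpr hi) ((even_iff_of_pow_eq D h').mpr hj)
  · exact D.pow_ne_pow_mul_w i j h'

omit [Fintype G] [DecidableEq G] in
/-- A coset element `uⁱ·w` with `i` odd is not in `⟨u², w⟩`. [folklore] -/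
theorem pow_mul_w_notMem_closure_of_odd {i : ℕ} (hi : Odd i) : D.u ^ i * D.w ∉ Subgroup.closure ({D.u ^ 2, D.w} : Set G) := fun h => by
  obtain ⟨j, hj, h' | h'⟩ := exists_even_of_mem_closure D h
  · exact D.pow_ne_pow_mul_w j i h'.symm
  · exact (Nat.not_even_iff_odd.mpr hi) ((even_iff_of_pow_eq D (mul_right_cancel h')).mpr hj)

omit [DecidableEq G] in
/-- **`⟨u², w⟩` has index two.** [folklore] -/
theorem index_closure_eq_two : (Subgroup.closure ({D.u ^ 2, D.w} : Set G)).index = 2 := by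
  rw [Subgroup.index_eq_two_iff]
  refine ⟨D.u, fun b => ?_⟩
  obtain ⟨i, -, rfl | rfl⟩ := D.exists_pow_or_pow_mul_w b
  · rw [← pow_succ]
    rcases Nat.even_or_odd i with hi | hi
    · exact Or.inr ⟨pow_mem_closure_of_even D hi, pow_notMem_closure_of_odd D hi.add_one⟩
    · exact Or.inl ⟨pow_mem_closure_of_even D hi.add_one, pow_notMem_closure_of_odd D hi⟩
  · rw [mul_assoc, D.htwist, ← mul_assoc, ← pow_add]
    rcases Nat.even_or_odd i with hi | hi
    · exact Or.inr ⟨pow_mul_w_mem_closure_of_even D hi, pow_mul_w_notMem_closure_of_odd D (hi.add_odd D.odd_r)⟩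
    · exact Or.inl ⟨pow_mul_w_mem_closure_of_even D (hi.add_odd D.odd_r), pow_mul_w_notMem_closure_of_odd D hi⟩

omit [Fintype G] [DecidableEq G] [NeZero n] in
/-- For `n` even, `c = uⁿ ∈ ⟨u², w⟩`. [folklore] -/
theorem c_mem_closure (hn : Even n) : c ∈ Subgroup.closure ({D.u ^ 2, D.w} : Set G) := by
  have h := pow_mem_closure_of_even D hn
  rwa [D.hun] at h

omit [Fintype G] [DecidableEq G] [NeZero n] in
/-- **A rotation `uⁱ` with `i` odd carries `c` among its powers**: `gcd(i, 2n)` is odd, so divides `n`, and `u^{gcd} ∈ ⟨uⁱ⟩` by Bézout. [folklore] -/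
theorem c_mem_zpowers_pow_of_odd {i : ℕ} (hi : Odd i) : c ∈ Subgroup.zpowers (D.u ^ i) := by
  set d := Nat.gcd i (2 * n) with hd
  have hdi : d ∣ i := Nat.gcd_dvd_left i (2 * n)
  have hd2n : d ∣ 2 * n := Nat.gcd_dvd_right i (2 * n)
  have hdodd : Odd d := hi.of_dvd_nat hdi
  have hdn : d ∣ n := Nat.Coprime.dvd_of_dvd_mul_left hdodd.coprime_two_right hd2n
  have hud : D.u ^ d ∈ Subgroup.zpowers (D.u ^ i) := by
    rw [Subgroup.mem_zpowers_iff]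
    refine ⟨Nat.gcdA i (2 * n), ?_⟩
    have hbez : ((d : ℕ) : ℤ) = (i : ℤ) * Nat.gcdA i (2 * n) + ((2 * n : ℕ) : ℤ) * Nat.gcdB i (2 * n) := Nat.gcd_eq_gcd_ab i (2 * n)
    have e : D.u ^ ((d : ℕ) : ℤ) = (D.u ^ i) ^ Nat.gcdA i (2 * n) := by
      rw [hbez, zpow_add, zpow_mul, zpow_mul, zpow_natCast, zpow_natCast, D.pow_two_mul, one_zpow, mul_one]
    rw [zpow_natCast] at e
    exact e.symm
  obtain ⟨m, hm⟩ := hdn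
  have h : D.u ^ (d * m) ∈ Subgroup.zpowers (D.u ^ i) := by
    rw [pow_mul]
    exact Subgroup.pow_mem _ hud m
  rwa [← hm, D.hun] at h

omit [DecidableEq G] in
/-- **Outside `⟨u², w⟩` every element carries `c`**, provided the odd coset elements `uⁱ·w` (`i` odd) do. [folklore] -/
theorem c_mem_zpowers_of_notMem_closure (hodd : ∀ i : ℕ, Odd i → c ∈ Subgroup.zpowers (D.u ^ i * D.w)) (y : G)
    (hy : y ∉ Subgroup.closure ({D.u ^ 2, D.w} : Set G)) : c ∈ Subgroup.zpowers y := by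
  obtain ⟨i, -, rfl | rfl⟩ := D.exists_pow_or_pow_mul_w y
  · rcases Nat.even_or_odd i with hi | hi
    · exact absurd (pow_mem_closure_of_even D hi) hy
    · exact c_mem_zpowers_pow_of_odd D hi
  · rcases Nat.even_or_odd i with hi | hi
    · exact absurd (pow_mul_w_mem_closure_of_even D hi) hy
    · exact hodd i hi

/-! ## §4 The law in datum terms -/

include D in
/-- **THE INDEX-TWO CYCLIC LAW `μ(G, c) = β − 1`.**  For every index-two cyclic datum of even level `n` whose odd coset elements `uⁱ·w` (`i` odd) carry
`c` among their powers — the modular and semidihedral groups and all `ℤ/2n ⋊_r ℤ/2` with `v₂(r+1) < v₂(2n)` — the least number of rank-four face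
relations whose base changes generate the integer Hodge lattice modulo the pairs is EXACTLY the number of blocks minus one. [folklore] -/
theorem isLeast_card_gfaces_generate_of_odd_coset (hc2 : c * c = 1) (hc1 : c ≠ 1) (hn : Even n)
    (hodd : ∀ i : ℕ, Odd i → c ∈ Subgroup.zpowers (D.u ^ i * D.w)) :
    IsLeast {m : ℕ | ∃ S : Finset (CMF G c →₀ ℤ), ↑S ⊆ gfaceSet G c hc2 ∧ S.card = m ∧
      hodgeSpan c hc2 ≤ Submodule.span ℤ (pairSet c) ⊔ Submodule.span ℤ (translates c S)} (Fintype.card (Block c) - 1) :=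
  isLeast_card_gfaces_generate D hc2 hc1 _ (index_closure_eq_two D) (c_mem_closure D hn) (c_mem_zpowers_of_notMem_closure D hodd)

include D in
/-- **`μ(G, c) = φ₂(G, c)`** in datum terms. [folklore] -/
theorem isLeast_card_gfaces_generate_fibreTwo_of_odd_coset (hc2 : c * c = 1) (hc1 : c ≠ 1) (hn : Even n)
    (hodd : ∀ i : ℕ, Odd i → c ∈ Subgroup.zpowers (D.u ^ i * D.w)) :
    IsLeast {m : ℕ | ∃ S : Finset (CMF G c →₀ ℤ), ↑S ⊆ gfaceSet G c hc2 ∧ S.card = m ∧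
      hodgeSpan c hc2 ≤ Submodule.span ℤ (pairSet c) ⊔ Submodule.span ℤ (translates c S)} (fibreTwo c hc2) :=
  isLeast_card_gfaces_generate_fibreTwo D hc2 hc1 _ (index_closure_eq_two D) (c_mem_closure D hn) (c_mem_zpowers_of_notMem_closure D hodd)

include D in
/-- **`β(G, c) = φ₂(G, c) + 1`** in datum terms. [folklore] -/
theorem card_block_eq_fibreTwo_add_one_of_odd_coset (hc2 : c * c = 1) (hc1 : c ≠ 1) (hn : Even n)
    (hodd : ∀ i : ℕ, Odd i → c ∈ Subgroup.zpowers (D.u ^ i * D.w)) : Fintype.card (Block c) = fibreTwo c hc2 + 1 :=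
  card_block_eq_fibreTwo_add_one D hc2 hc1 _ (index_closure_eq_two D) (c_mem_closure D hn) (c_mem_zpowers_of_notMem_closure D hodd)

include D in
/-- **`d₂(G/𝒦) = 1`** in datum terms. [folklore] -/
theorem indexTwoRank_stabGen_eq_one_of_odd_coset (hc2 : c * c = 1) (hc1 : c ≠ 1) (hn : Even n)
    (hodd : ∀ i : ℕ, Odd i → c ∈ Subgroup.zpowers (D.u ^ i * D.w)) : indexTwoRank (stabGen c) = 1 :=
  indexTwoRank_stabGen_eq_one D hc2 hc1 _ (index_closure_eq_two D) (c_mem_closure D hn) (c_mem_zpowers_of_notMem_closure D hodd)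

omit [Fintype G] [DecidableEq G] [NeZero n] in
/-- The square of a coset element: `(uⁱ·w)² = u^{(r+1)i}`. [folklore] -/
theorem pow_mul_w_sq (i : ℕ) : (D.u ^ i * D.w) ^ 2 = D.u ^ ((D.r + 1) * i) := by
  rw [pow_two, mul_assoc, ← mul_assoc D.w, D.w_mul_pow, mul_assoc, D.hww, mul_one, ← pow_add, add_mul, one_mul, add_comm]

omit [Fintype G] [DecidableEq G] [NeZero n] in
/-- **The odd-coset hypothesis from the twist**: if `c ∈ ⟨u^{r+1}⟩` (i.e. `v₂(r+1) < v₂(2n)`: modular `r = n+1` with `4 ∣ n`, semidihedral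
`r = n−1`, …) then every odd coset element `uⁱ·w`, `i` odd, carries `c` among its powers: `(uⁱw)^{2k} = ((u^{r+1})ᵏ)ⁱ = cⁱ = c`. [folklore] -/
theorem odd_coset_of_mem_zpowers_twist (hc2 : c * c = 1) (h : c ∈ Subgroup.zpowers (D.u ^ (D.r + 1))) (i : ℕ) (hi : Odd i) :
    c ∈ Subgroup.zpowers (D.u ^ i * D.w) := by
  obtain ⟨k, hk⟩ := Subgroup.mem_zpowers_iff.mp h
  rw [Subgroup.mem_zpowers_iff]
  refine ⟨2 * k, ?_⟩
  have e : (D.u ^ i * D.w) ^ (2 * k) = ((D.u ^ (D.r + 1)) ^ k) ^ i := by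
    rw [zpow_mul, zpow_ofNat, pow_mul_w_sq, pow_mul]
    rw [← zpow_natCast (D.u ^ (D.r + 1)) i, ← zpow_mul, ← zpow_natCast ((D.u ^ (D.r + 1)) ^ k) i, ← zpow_mul, mul_comm]
  rw [e, hk, ComplementFaces.pow_eq_self_of_odd c hc2 hi]

include D in
/-- **THE INDEX-TWO CYCLIC LAW from the twist**: `n` even and `c ∈ ⟨u^{r+1}⟩` ⇒ `μ(G, c) = β − 1`. [folklore] -/
theorem isLeast_card_gfaces_generate_of_twist (hc2 : c * c = 1) (hc1 : c ≠ 1) (hn : Even n) (hr : c ∈ Subgroup.zpowers (D.u ^ (D.r + 1))) :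
    IsLeast {m : ℕ | ∃ S : Finset (CMF G c →₀ ℤ), ↑S ⊆ gfaceSet G c hc2 ∧ S.card = m ∧
      hodgeSpan c hc2 ≤ Submodule.span ℤ (pairSet c) ⊔ Submodule.span ℤ (translates c S)} (Fintype.card (Block c) - 1) :=
  isLeast_card_gfaces_generate_of_odd_coset D hc2 hc1 hn (odd_coset_of_mem_zpowers_twist D hc2 hr)

include D in
/-- **`μ(G, c) = φ₂(G, c)` from the twist.** [folklore] -/
theorem isLeast_card_gfaces_generate_fibreTwo_of_twist (hc2 : c * c = 1) (hc1 : c ≠ 1) (hn : Even n)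
    (hr : c ∈ Subgroup.zpowers (D.u ^ (D.r + 1))) :
    IsLeast {m : ℕ | ∃ S : Finset (CMF G c →₀ ℤ), ↑S ⊆ gfaceSet G c hc2 ∧ S.card = m ∧
      hodgeSpan c hc2 ≤ Submodule.span ℤ (pairSet c) ⊔ Submodule.span ℤ (translates c S)} (fibreTwo c hc2) :=
  isLeast_card_gfaces_generate_fibreTwo_of_odd_coset D hc2 hc1 hn (odd_coset_of_mem_zpowers_twist D hc2 hr)

include D in
/-- **`β = φ₂ + 1` from the twist.** [folklore] -/
theorem card_block_eq_fibreTwo_add_one_of_twist (hc2 : c * c = 1) (hc1 : c ≠ 1) (hn : Even n)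
    (hr : c ∈ Subgroup.zpowers (D.u ^ (D.r + 1))) : Fintype.card (Block c) = fibreTwo c hc2 + 1 :=
  card_block_eq_fibreTwo_add_one_of_odd_coset D hc2 hc1 hn (odd_coset_of_mem_zpowers_twist D hc2 hr)

end

end Summit.HodgeConjecture.CorCM.Census.IndexTwoCyclic
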